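/-
Copyright (c) 2026 the pub-hodgecm-mathlib formalisation cell (harness21).  Prover seat hodgecm-mathlib-K2Liu-p05 (g4), 2026-09-04
(Track B «K2-LIT», crux hLiu418 = stmt-HodgeConjecture-24832, LEAD F0P6-plan (g13) RULING M-157i′ organ (SD-1):
polynomial × Gaussian vectors are derivatives of SHIFTED GAUSSIANS — part (L1), the one-complex-line letter).
-/
import Literature.Analysis.SegalBargmann.FockBargmannKernel            -- ★ `bkerCore` (the shifted-Gaussian ∕ Bargmann kernel), `gauss`, `hermiteFun`
import Literature.Analysis.SegalBargmann.SchwartzBargmannIntertwining   -- ★ `hermiteSchwartzPi` (poly × Gaussian as a Schwartz map on `σ → ℝ`)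
import Mathlib.Analysis.SpecialFunctions.ExpDeriv
import Mathlib.Analysis.Calculus.IteratedDeriv.Lemmas
import HarnessLib

/-!
# (SD-1, L1) Shifted Gaussians along a complex line and their `t`-derivatives: `(d∕dt)^d e^{−π|x|²+2πt ξ·x} = (2π ξ·x)^d · (same)`

Track B ∕ K2-LIT, hLiu418 = stmt-HodgeConjecture-24832; LEAD F0P6-plan (g13) RULING M-157i′ (SD-1) «`P(x,x̄)·e^{−π⟨x,x⟩}` is a finite derivative-combination
of the SHIFTED Gaussians `e^{π⟨u,u⟩}·e^{−π⟨x−u,x−u⟩}` … Schwartz-valued identity + the coefficient table» (consumer (SD-2) K2E5-p16 (g5): arch integrals of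
shifted-Gaussian sections are holomorphic in the shift, Cauchy estimates carry holomorphy and growth to every `K_∞`-type).  Namespace
`Summit.HodgeConjecture.HodgeConjecture.Cruxes.HLiu418.K2LiuPolyGaussianShiftDerivatives`.  THEOREMS ONLY (no definition, no instance, no notation, no named
fact, no `sorry`); `--supports stmt-HodgeConjecture-24832 --as helper`.

DICTIONARY.  The shifted-Gaussian family IS the tree's Bargmann kernel ★ `bkerCore z x = exp (Σ_k (−π x_k² + 2π z_k x_k)) = e^{−π|x|²} e^{2π z·x}` (`z ∈ ℂ^σ` a
COMPLEX shift; at a real shift `z = u`: `e^{π|u|²} e^{−π|x−u|²}`, `bkerCore_ofReal`), and poly × Gaussian is ★ `hermiteFun p x = p(x) e^{−π|x|²}`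
(`p ∈ ℂ[x_σ]`, Schwartz packaging ★ `hermiteSchwartzPi p`).  This file is the ONE-COMPLEX-LINE letter: along `z = t ξ` (`ξ ∈ ℂ^σ` fixed, `t ∈ ℂ`),
* `bkerCore_smul` : `bkerCore (t • ξ) x = e^{−π|x|²} · exp (t · 2π ξ·x)`; `bkerCore_zero`; `differentiable_bkerCore_smul` (entire in `t`);
* **`iteratedDeriv_bkerCore_smul`** : `(d∕dt)^d bkerCore (t • ξ) x = (2π ξ·x)^d · bkerCore (t • ξ) x` at every `t` (Mathlib `iteratedDeriv_cexp_const_mul`), and at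
  `t = 0`: **`iteratedDeriv_bkerCore_smul_zero`** `= hermiteFun ((2π ξ·X)^d) x` — the Gaussian times the `d`-th power of the linear form `2π Σ_k ξ_k x_k`
  (the `d`-th `t`-derivative of the shifted Gaussian IS a polynomial × Gaussian vector, symbol `(C (2π) · Σ_k C ξ_k X_k)^d`); Schwartz reading
  `iteratedDeriv_bkerCore_smul_zero_eq_hermiteSchwartzPi`;
* `bkerCore_ofReal` : the real-shift reading `bkerCore u x = e^{π|u|²} · e^{−π|x−u|²}` (LEAD's letter).
Sequel (L2, after the consumer's «=»): POLARISATION `d!·∏_j X_{i j} = Σ_{S ⊆ [d]} (−1)^{d−|S|} (Σ_{j∈S} X_{i j})^d` ⇒ every monomial × Gaussian, hence every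
`hermiteFun p`, is an explicit finite combination of `d`-th line derivatives at `t = 0` along real `0∕1` directions (the coefficient table).

HONEST LABEL: HC_CM is proved only modulo the 7 printed citations (2 remaining named inputs: hLiu418 = stmt-HodgeConjecture-24832, h413 =
stmt-HodgeConjecture-24833) until rung 0 closes; organ capital, moves no counter.

## References
[Folland1989] G. B. Folland, *Harmonic Analysis in Phase Space* (1989), §1.6 (the Bargmann kernel `e^{2πxz−πx²−(π∕2)z²}`), §1.7 (Hermite functions), (1.66)–(1.67)
(coherent states) · [Howe1989] R. Howe, *Transcending classical invariant theory*, J. Amer. Math. Soc. 2 (1989), §3 (polynomial Fock model).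
-/

set_option autoImplicit false
set_option linter.dupNamespace false

noncomputable section

open Complex MvPolynomial
open scoped Real
open Literature.Analysis.SegalBargmann

namespace Summit.HodgeConjecture.HodgeConjecture.Cruxes.HLiu418.K2LiuPolyGaussianShiftDerivatives

variable {σ : Type*} [Fintype σ]

/-! ## §1 The shifted Gaussian along a complex line -/

/-- **`bkerCore (t • ξ) x = e^{−π|x|²} · exp (t · 2π Σ_k ξ_k x_k)`** — along the complex line `z = t ξ` the Bargmann kernel is the Gaussian times a one-variable
exponential. [cite: Folland1989, §1.6] -/
theorem bkerCore_smul (ξ : σ → ℂ) (t : ℂ) (x : σ → ℝ) :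
    bkerCore (t • ξ) x = gauss x * cexp (((2 * π : ℂ) * ∑ k, ξ k * (x k : ℂ)) * t) := by
  rw [bkerCore, gauss, ← Complex.exp_add, Finset.sum_add_distrib, Finset.mul_sum, Finset.mul_sum, Finset.sum_mul]
  congr 1
  refine congrArg₂ (· + ·) rfl (Finset.sum_congr rfl fun k _ => ?_)
  rw [Pi.smul_apply, smul_eq_mul]
  ring

/-- at the origin of the line: `bkerCore 0 x = e^{−π|x|²}`. [cite: Folland1989, §1.6] -/
theorem bkerCore_zero (x : σ → ℝ) : bkerCore (0 : σ → ℂ) x = gauss x := by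
  have h := bkerCore_smul (0 : σ → ℂ) 0 x
  rwa [zero_smul, mul_zero, Complex.exp_zero, mul_one] at h

/-- `t ↦ bkerCore (t • ξ) x` is ENTIRE. [cite: Folland1989, §1.6] -/
theorem differentiable_bkerCore_smul (ξ : σ → ℂ) (x : σ → ℝ) : Differentiable ℂ fun t : ℂ => bkerCore (t • ξ) x := by
  simp only [bkerCore_smul]
  exact (differentiable_const _).mul (Complex.differentiable_exp.comp ((differentiable_const _).mul differentiable_id))

/-- **the real-shift reading** (LEAD M-157i′'s letter): for a REAL shift `u`, `bkerCore u x = e^{π|u|²} · e^{−π|x−u|²}`. [cite: Folland1989, §1.6 and (1.66)] -/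
theorem bkerCore_ofReal (u x : σ → ℝ) :
    bkerCore (fun k => (u k : ℂ)) x = cexp ((π : ℂ) * ∑ k, ((u k : ℂ)) ^ 2) * gauss (x - u) := by
  rw [bkerCore, gauss, ← Complex.exp_add, Finset.mul_sum, Finset.mul_sum, ← Finset.sum_add_distrib]
  congr 1
  refine Finset.sum_congr rfl fun k _ => ?_
  rw [Pi.sub_apply, Complex.ofReal_sub]
  ring

/-! ## §2 The `t`-derivatives: `(d∕dt)^d` of the shifted Gaussian is a polynomial × Gaussian vector -/

/-- **`(d∕dt)^d bkerCore (t • ξ) x = (2π Σ_k ξ_k x_k)^d · bkerCore (t • ξ) x`** at every `t ∈ ℂ` (Mathlib `iteratedDeriv_cexp_const_mul`).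
[cite: Folland1989, §1.6] -/
theorem iteratedDeriv_bkerCore_smul (d : ℕ) (ξ : σ → ℂ) (x : σ → ℝ) (t : ℂ) :
    iteratedDeriv d (fun s : ℂ => bkerCore (s • ξ) x) t = ((2 * π : ℂ) * ∑ k, ξ k * (x k : ℂ)) ^ d * bkerCore (t • ξ) x := by
  have hfun : (fun s : ℂ => bkerCore (s • ξ) x) = fun s : ℂ => gauss x * cexp (((2 * π : ℂ) * ∑ k, ξ k * (x k : ℂ)) * s) :=
    funext fun s => bkerCore_smul ξ s x
  rw [hfun, iteratedDeriv_const_mul_field, iteratedDeriv_cexp_const_mul, bkerCore_smul]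
  ring

/-- **AT `t = 0`: `(d∕dt)^d|₀ bkerCore (t • ξ) x = hermiteFun ((2π ξ·X)^d) x`** — the Gaussian times the `d`-th power of the linear form, i.e. the polynomial × Gaussian
vector with symbol `(C (2π) · Σ_k C (ξ k) · X k)^d`. [cite: Folland1989, §1.7] [cite: Howe1989, §3] -/
theorem iteratedDeriv_bkerCore_smul_zero (d : ℕ) (ξ : σ → ℂ) (x : σ → ℝ) :
    iteratedDeriv d (fun s : ℂ => bkerCore (s • ξ) x) 0 = hermiteFun ((C (2 * π : ℂ) * ∑ k, C (ξ k) * X k) ^ d) x := by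
  rw [iteratedDeriv_bkerCore_smul, zero_smul, bkerCore_zero, hermiteFun]
  congr 1
  simp only [map_pow, map_mul, map_sum, eval_C, eval_X]

/-- **Schwartz reading**: `(d∕dt)^d|₀ bkerCore (t • ξ) x = (hermiteSchwartzPi ((2π ξ·X)^d)) x` — the `d`-th line derivative of the shifted Gaussian at the origin IS
(pointwise) the Schwartz vector `hermiteSchwartzPi ((C 2π · Σ C ξ_k X_k)^d)` of the Weil files' carrier `𝓢(σ → ℝ, ℂ)`. [cite: Folland1989, §1.7] -/
theorem iteratedDeriv_bkerCore_smul_zero_eq_hermiteSchwartzPi (d : ℕ) (ξ : σ → ℂ) (x : σ → ℝ) :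
    iteratedDeriv d (fun s : ℂ => bkerCore (s • ξ) x) 0 = hermiteSchwartzPi ((C (2 * π : ℂ) * ∑ k, C (ξ k) * X k) ^ d) x := by
  rw [hermiteSchwartzPi_apply, iteratedDeriv_bkerCore_smul_zero]

/-- **first derivative, `HasDerivAt` form** (what a Cauchy-estimate ∕ dominated-differentiation consumer feeds term by term):
`d∕dt bkerCore (t • ξ) x = (2π ξ·x) · bkerCore (t • ξ) x`. [cite: Folland1989, §1.6] -/
theorem hasDerivAt_bkerCore_smul (ξ : σ → ℂ) (x : σ → ℝ) (t : ℂ) :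
    HasDerivAt (fun s : ℂ => bkerCore (s • ξ) x) (((2 * π : ℂ) * ∑ k, ξ k * (x k : ℂ)) * bkerCore (t • ξ) x) t := by
  have h := (differentiable_bkerCore_smul ξ x t).hasDerivAt
  have hd : deriv (fun s : ℂ => bkerCore (s • ξ) x) t = ((2 * π : ℂ) * ∑ k, ξ k * (x k : ℂ)) * bkerCore (t • ξ) x := by
    have := iteratedDeriv_bkerCore_smul 1 ξ x t
    rwa [iteratedDeriv_one, pow_one] at this
  rwa [hd] at h

end Summit.HodgeConjecture.HodgeConjecture.Cruxes.HLiu418.K2LiuPolyGaussianShiftDerivatives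

end
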